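import Summits.ABC.StewartYu.PadicG3TwoMainSiegel
import Summits.ABC.StewartYu.PadicG3TwoMainChainSat
import HarnessLib

/-!
# Cell abc-stewartyu, WP-L.P(2) (crux r4 `PadicCoreTwoRat`, stmt-ABC-20504), layer START: Siegel's lemma on the slab
# class of the 𝔑-THREADED family — the Siegel step with an abstract monomial-clearing datum and `SiegelTwo σ (ShSat …)`

`Summits/ABC/StewartYu/PadicG3TwoSiegelSat.lean` — cell `abc-stewartyu` (HOME `run/shared/lean/pub/abc-stewartyu/`),
route `YuMatveevShapeRat`, seat p3 (g9, WP-L.P(2) lead; design memo HOME/p3/memo-11 §2 row «Siegel / START»).  Theorems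
on `TwoSetup`; no definition, no named fact.

Twins of `PadicG3TwoSiegel.exists_g3_siegel`, `PadicG3TwoSlabSiegel.exists_g3_slab_siegel` and
`PadicG3TwoMainSiegel.siegelTwo_of_slab_siegel` with the coefficient-size line on an ABSTRACT monomial-clearing datum
(`Dm x · zmon(uᵢ, u_θᵢ, x) ∈ ℤ`, `|·| ≤ Mm x` — `PadicG3TwoValuesGen`) instead of the coordinate-box denominator
`monDen all (boxExp Dbox Dθ x)`, and — in the level-`0` statement — the datum SUPPLIED from the virtual box of the
pre-family (`PadicTwoSatData.SatData.monomialDatum_of_vbox`), landing in the shape slot `ShSat F Bv Sh` of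
`PadicG3TwoMainChainSat`:

* `exists_g3_siegel_gen` — Siegel's lemma for the system `g3φ τ x = 0`, `(x, τ) ∈ E`, `2·#E ≤ #B`, with
  `Amax ≥ M₀·Xb^{|t|}·Mm x` on `E`;
* `exists_g3_slab_siegel_gen` — the same on the slab class (`2·2^m·#E ≤ #B`, slab depth `m` from `‖Λ₀‖ ≤ 2^{−(m+3)}`);
* **`siegelTwo_of_slab_siegel_sat`** — `SiegelTwo σ (ShSat F Bv Sh)` from a pre-family `(B₀, R, u, u_θ)` in the
  VIRTUAL box `Bv 0` (and the schedule's coordinate box / directional bound / weights / `Y₀`-data), the equation count,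
  and `Amax ≥ M₀max·Xb 0^{|t|}·Dm(Bv 0, x)²` on `[−N0 0, N0 0] × {|τ| < T0 0}`.

WHAT THIS IS NOT: no pre-family (Feldman basis × skew box: the assembler, with p1's lattice-point count), no numbers;
no crux moves (A1.L not moved).

References: K. Yu, Acta Math. 211 (2013), Lemma 4.2 and (5.22); K. Yu, Acta Arith. 89 (1999) p. 340 (slab class);
Yu. V. Nesterenko, LNM 1819 (2003) §3.3–3.5 (Siegel step on the lattice `𝔑`), Lemma 3.11; HOME/p3/memo-11 §2.
-/

noncomputable section

open Finset Polynomial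
open scoped Matrix
open Literature.NumberTheory.Transcendental
open Literature.NumberTheory.Transcendental.CW77.Setup (Tau tauNorm tauSet mem_tauSet)

namespace Summit.ABC.StewartYu

namespace TwoSetup

variable (S : TwoSetup) {ι : Type*} (R : ι → ℚ[X]) (u : ι → Fin S.d → ℤ) (uθ : ι → ℤ)

/-! ### Siegel's lemma with an abstract monomial datum -/

/-- **The Siegel step of the Gen-3 `2`-adic frame on an abstract monomial-clearing datum.**  Unknowns `i ∈ B`
(directional scalars `|𝔛ⱼ(i)| ≤ Xb`, monomials cleared by `Dm x` with numerators `≤ Mm x`), equations `(x, τ) ∈ E`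
(nonempty, `2·#E ≤ #B`), `Y₀`-weight data `den₀(x,τ) ≥ 1`, `den₀·(Hasse_{t₀} Rᵢ)(x) ∈ ℤ` of size `≤ M₀`, and
`Amax ≥ M₀·Xb^{|t|}·Mm x` on `E`: an integer vector `p` supported in `B`, not all zero, `|pᵢ| ≤ ⌈#B·Amax⌉`, with
`g3φ τ x = 0` for all `(x, τ) ∈ E`. [cite: Yu2013, Lemma 4.2] [cite: Nesterenko2003, §3.3–3.5; shape only] -/
theorem exists_g3_siegel_gen [DecidableEq ι] (B : Finset ι) (E : Finset (ℤ × Tau S.d)) (hE : E.Nonempty)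
    (hcard : 2 * E.card ≤ B.card)
    (den₀ : ℤ × Tau S.d → ℕ) (hden₀ : ∀ e ∈ E, 1 ≤ den₀ e) {M₀ : ℤ}
    (hR : ∀ e ∈ E, ∀ i ∈ B,
      ∃ z₀ : ℤ, (den₀ e : ℚ) * (hasseDeriv e.2.1 (R i)).eval (e.1 : ℚ) = z₀ ∧ |z₀| ≤ M₀)
    {Xb : ℤ} (hX : ∀ i ∈ B, ∀ j, |S.dirScalar (u i) (uθ i) j| ≤ Xb)
    (Dm : ℤ → ℕ) (hDm : ∀ x, 1 ≤ Dm x) (Mm : ℤ → ℤ)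
    (hm : ∀ x : ℤ, ∀ i ∈ B, ∃ z₂ : ℤ, ((Dm x : ℕ) : ℚ) * S.zmon (u i) (uθ i) x = z₂ ∧ |z₂| ≤ Mm x)
    {Amax : ℝ} (hAmax : 1 ≤ Amax)
    (hA : ∀ e ∈ E, (M₀ : ℝ) * (Xb : ℝ) ^ (∑ j, e.2.2 j) * (Mm e.1 : ℝ) ≤ Amax) :
    ∃ p : ι → ℤ, (∀ i, p i ≠ 0 → i ∈ B) ∧ (∃ i, p i ≠ 0) ∧
      (∀ i, |p i| ≤ ⌈(B.card : ℝ) * Amax⌉) ∧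
      ∀ e ∈ E, S.g3φ R u uθ B p e.2 e.1 = 0 := by
  classical
  -- the landed `exists_g3_siegel` with the clearing line swapped
  set coeff : ℤ × Tau S.d → ι → ℚ := fun e i =>
    (hasseDeriv e.2.1 (R i)).eval (e.1 : ℚ) * S.zγpow u uθ i e.2.2 * S.zmon (u i) (uθ i) e.1 with hcoeff
  set Dc : ℤ × Tau S.d → ℕ := fun e => den₀ e * S.bθ.natAbs ^ (∑ j, e.2.2 j) * Dm e.1 with hDc
  have hb1 : 1 ≤ S.bθ.natAbs := Int.natAbs_pos.mpr S.bθ_ne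
  have hDpos : ∀ e ∈ E, 0 < Dc e := by
    intro e he
    have : 1 ≤ Dc e := one_le_mul (one_le_mul (hden₀ e he) (Nat.one_le_pow _ _ hb1)) (hDm e.1)
    omega
  have hclear : ∀ e ∈ E, ∀ i ∈ B, ∃ z : ℤ, (Dc e : ℚ) * coeff e i = z ∧
      |z| ≤ M₀ * Xb ^ (∑ j, e.2.2 j) * Mm e.1 := by
    intro e he i hi
    exact S.exists_int_clear_mul_coef_gen R u uθ i e.2 e.1 (hR e he i hi) (hX i hi) (hm e.1 i hi)
  have hint : ∀ e ∈ E, ∀ i ∈ B, ∃ z : ℤ, (Dc e : ℚ) * coeff e i = z :=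
    fun e he i hi => by obtain ⟨z, hz, _⟩ := hclear e he i hi; exact ⟨z, hz⟩
  have hAbound : ∀ e ∈ E, ∀ i ∈ B, ((|(Dc e : ℚ) * coeff e i| : ℚ) : ℝ) ≤ Amax := by
    intro e he i hi
    obtain ⟨z, hz, hzle⟩ := hclear e he i hi
    rw [hz]
    push_cast
    have h1 : |(z : ℝ)| ≤ (M₀ : ℝ) * (Xb : ℝ) ^ (∑ j, e.2.2 j) * (Mm e.1 : ℝ) := by
      have := (Int.cast_le (R := ℝ)).mpr hzle
      push_cast at this
      exact this
    exact h1.trans (hA e he)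
  obtain ⟨p, hsupp, hne, hbound, hsol⟩ :=
    SiegelFinset.exists_int_vec_of_finset B E hE hcard coeff Dc hDpos hint hAmax hAbound
  refine ⟨p, hsupp, hne, hbound, fun e he => ?_⟩
  have h := hsol e he
  unfold g3φ
  rw [← h]
  refine Finset.sum_congr rfl fun i _ => ?_
  simp only [hcoeff]
  ring

/-- **Siegel's lemma on the SLAB CLASS with an abstract monomial datum**: under `‖Λ₀‖ ≤ 2^{−(m+3)}`, equations `E`
(nonempty) with `2·2^m·#E ≤ #B`: a slab class `𝔏 ⊆ B` (`#B ≤ 2^m·#𝔏`, nonempty, slab hypothesis for every base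
point) and coefficients `p` supported in `𝔏`, not all zero, `|pᵢ| ≤ ⌈#𝔏·Amax⌉`, solving the system on `𝔏`.
[cite: Yu1999, p. 340] [cite: Yu2013, Lemma 4.2] -/
theorem exists_g3_slab_siegel_gen [DecidableEq ι] (B : Finset ι) (m : ℕ)
    (hΛ : ‖S.Λ₀‖ ≤ ((2 : ℝ) ^ (m + 3))⁻¹)
    (E : Finset (ℤ × Tau S.d)) (hE : E.Nonempty) (hcard : 2 * 2 ^ m * E.card ≤ B.card)
    (den₀ : ℤ × Tau S.d → ℕ) (hden₀ : ∀ e ∈ E, 1 ≤ den₀ e) {M₀ : ℤ}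
    (hR : ∀ e ∈ E, ∀ i ∈ B,
      ∃ z₀ : ℤ, (den₀ e : ℚ) * (hasseDeriv e.2.1 (R i)).eval (e.1 : ℚ) = z₀ ∧ |z₀| ≤ M₀)
    {Xb : ℤ} (hX : ∀ i ∈ B, ∀ j, |S.dirScalar (u i) (uθ i) j| ≤ Xb)
    (Dm : ℤ → ℕ) (hDm : ∀ x, 1 ≤ Dm x) (Mm : ℤ → ℤ)
    (hm : ∀ x : ℤ, ∀ i ∈ B, ∃ z₂ : ℤ, ((Dm x : ℕ) : ℚ) * S.zmon (u i) (uθ i) x = z₂ ∧ |z₂| ≤ Mm x)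
    {Amax : ℝ} (hAmax : 1 ≤ Amax)
    (hA : ∀ e ∈ E, (M₀ : ℝ) * (Xb : ℝ) ^ (∑ j, e.2.2 j) * (Mm e.1 : ℝ) ≤ Amax) :
    ∃ (𝔏 : Finset ι) (p : ι → ℤ), 𝔏 ⊆ B ∧ B.card ≤ 2 ^ m * 𝔏.card ∧ 𝔏.Nonempty ∧
      (∀ i₀ ∈ 𝔏, ∀ i ∈ 𝔏, ‖S.δexpo u uθ i₀ i‖ ≤ ((2 : ℝ) ^ (m + 3))⁻¹) ∧
      (∀ i, p i ≠ 0 → i ∈ 𝔏) ∧ (∃ i, p i ≠ 0) ∧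
      (∀ i, |p i| ≤ ⌈(𝔏.card : ℝ) * Amax⌉) ∧
      ∀ e ∈ E, S.g3φ R u uθ 𝔏 p e.2 e.1 = 0 := by
  obtain ⟨𝔏, hsub, hcnt, hslab⟩ := S.exists_slabTwo u uθ m B hΛ
  have h2m : 0 < 2 ^ m := pow_pos two_pos m
  have hcard' : 2 * E.card ≤ 𝔏.card :=
    SiegelFinset.two_mul_card_le_of_class h2m hcnt (by simpa [mul_comm, mul_assoc, mul_left_comm] using hcard)
  have h𝔏ne : 𝔏.Nonempty := by
    rw [← Finset.card_pos]
    have := Finset.card_pos.mpr hE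
    omega
  obtain ⟨p, hsupp, hne, hbound, hsol⟩ :=
    S.exists_g3_siegel_gen R u uθ 𝔏 E hE hcard' den₀ hden₀ (fun e he i hi => hR e he i (hsub hi))
      (fun i hi => hX i (hsub hi)) Dm hDm Mm (fun x i hi => hm x i (hsub hi)) hAmax hA
  exact ⟨𝔏, p, hsub, hcnt, h𝔏ne, hslab, hsupp, hne, hbound, hsol⟩

/-! ### Level `0` of the induction on the 𝔑-threaded family -/

variable {S}

/-- **LEVEL `0` OF THE LEVEL INDUCTION ON THE 𝔑-THREADED FAMILY: `SiegelTwo σ (ShSat F Bv Sh)` from Siegel's lemma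
on the slab class.**  Pre-family `(B₀, R, u, u_θ)` in the VIRTUAL box `Bv 0` (`|(κᵢ ᵥ* U)ⱼ| ≤ Bv 0 j`) and in the
schedule's coordinate box / directional bound (coarse, for the directional scalars only); equation count
`2·2^m·#([−N0 0, N0 0] × {|τ| < T0 0}) ≤ #B₀`; `Amax ≥ M₀max·Xb 0^{|t|}·Dm(Bv 0, x)²` on the equation set;
`⌈cardB 0 · Amax⌉ ≤ P`. [cite: Yu2013, Lemma 4.2 and (5.22)] [cite: Nesterenko2003, §3.5; shape only] -/
theorem siegelTwo_of_slab_siegel_sat [DecidableEq ι] (σ : S.G3TwoSched) (F : S.SatData)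
    (Bv : ℕ → Fin (S.d + 1) → ℕ) (Sh : ℕ → S.G3Fam ι → Prop)
    (B₀ : Finset ι) (R : ι → ℚ[X]) (u : ι → Fin S.d → ℤ) (uθ : ι → ℤ)
    (hΛ : ‖S.Λ₀‖ ≤ ((2 : ℝ) ^ (σ.m + 3))⁻¹) (hT : 1 ≤ σ.T0 0)
    (hcount : 2 * 2 ^ σ.m * ((Finset.Icc (-(σ.N0 0 : ℤ)) (σ.N0 0)) ×ˢ tauSet S.d (σ.T0 0)).card ≤
      B₀.card)
    (hcardB : B₀.card ≤ σ.cardB 0)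
    (hdeg_ne : ∀ i ∈ B₀, ∀ i' ∈ B₀, S.allκ u uθ i = S.allκ u uθ i' → i ≠ i' →
      (R i).natDegree ≠ (R i').natDegree)
    (hR_ne : ∀ i ∈ B₀, R i ≠ 0) (hdeg_le : ∀ i ∈ B₀, (R i).natDegree ≤ σ.D₀)
    (hu : ∀ i ∈ B₀, ∀ j, |u i j| ≤ (σ.Dbox 0 j : ℤ)) (huθ : ∀ i ∈ B₀, |uθ i| ≤ (σ.Dθ 0 : ℤ))
    (hvbox : ∀ i ∈ B₀, ∀ j, |(S.allκ u uθ i ᵥ* F.U) j| ≤ (Bv 0 j : ℤ))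
    (hdir : ∀ i ∈ B₀, ∀ j, |S.dirScalar (u i) (uθ i) j| ≤ σ.Xb 0)
    (hwt : ∀ i ∈ B₀, ∀ t₀ k, ‖(hw R i t₀).coeff k‖ * (4 * (2 : ℝ) ^ σ.m) ^ k ≤ σ.Bw 0)
    (hhasse : ∀ i ∈ B₀, ∀ (x : ℤ) (τ : Tau S.d), ∃ z₀ : ℤ,
      (σ.den₀ 0 x τ : ℚ) * (hasseDeriv τ.1 (R i)).eval (x : ℚ) = z₀ ∧ |z₀| ≤ σ.M₀ 0 x τ)
    (hden₀ : ∀ (x : ℤ) (τ : Tau S.d), 1 ≤ σ.den₀ 0 x τ)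
    {M₀max : ℤ} (hM₀max : ∀ x : ℤ, |x| ≤ (σ.N0 0 : ℤ) → ∀ τ : Tau S.d, tauNorm τ < σ.T0 0 →
      σ.M₀ 0 x τ ≤ M₀max)
    {Amax : ℝ} (hAmax : 1 ≤ Amax)
    (hA : ∀ x : ℤ, |x| ≤ (σ.N0 0 : ℤ) → ∀ τ : Tau S.d, tauNorm τ < σ.T0 0 →
      (M₀max : ℝ) * (σ.Xb 0 : ℝ) ^ (∑ j, τ.2 j) * ((F.Dm (Bv 0) x : ℝ)) ^ 2 ≤ Amax)
    (hP : ⌈(σ.cardB 0 : ℝ) * Amax⌉ ≤ σ.P)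
    (hSh : ∀ 𝔏 : Finset ι, 𝔏 ⊆ B₀ → ∀ i₀ ∈ 𝔏, ∀ p : ι → ℤ, Sh 0 ⟨𝔏, R, u, uθ, p, i₀⟩) :
    SiegelTwo σ (ShSat F Bv Sh) := by
  classical
  set E : Finset (ℤ × Tau S.d) := (Finset.Icc (-(σ.N0 0 : ℤ)) (σ.N0 0)) ×ˢ tauSet S.d (σ.T0 0) with hE
  have hmemE : ∀ e ∈ E, |e.1| ≤ (σ.N0 0 : ℤ) ∧ tauNorm e.2 < σ.T0 0 := by
    intro e he
    rw [hE, Finset.mem_product, Finset.mem_Icc, mem_tauSet] at he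
    exact ⟨abs_le.mpr he.1, he.2⟩
  have hEne : E.Nonempty := by
    refine ⟨((0 : ℤ), ((0 : ℕ), fun _ => (0 : ℕ))), ?_⟩
    refine mem_Icc_product_tauSet (by simp) ?_
    unfold tauNorm
    simp only [Finset.sum_const_zero, add_zero]
    omega
  -- the monomial datum of the pre-family from the virtual box
  have hm := F.monomialDatum_of_vbox u uθ hvbox
  -- Siegel's lemma on the slab class
  obtain ⟨𝔏, p, hsub, _hcnt, h𝔏ne, hslab, hsupp, hne, hbound, hsol⟩ :=
    S.exists_g3_slab_siegel_gen R u uθ B₀ σ.m hΛ E hEne hcount (fun e => σ.den₀ 0 e.1 e.2)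
      (fun e _ => hden₀ e.1 e.2) (M₀ := M₀max)
      (fun e he i hi => by
        obtain ⟨z₀, hz₀, hle⟩ := hhasse i hi e.1 e.2
        exact ⟨z₀, hz₀, hle.trans (hM₀max e.1 (hmemE e he).1 e.2 (hmemE e he).2)⟩)
      hdir (F.Dm (Bv 0)) (F.one_le_Dm (Bv 0)) (fun x => ((F.Dm (Bv 0) x : ℤ)) ^ 2) hm hAmax
      (fun e he => by
        have := hA e.1 (hmemE e he).1 e.2 (hmemE e he).2
        push_cast at this ⊢
        exact this)
  obtain ⟨i₀, hi₀⟩ := h𝔏ne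
  refine ⟨⟨𝔏, R, u, uθ, p, i₀⟩, ?_, ?_⟩
  · have hcard𝔏 : 𝔏.card ≤ σ.cardB 0 := (Finset.card_le_card hsub).trans hcardB
    have hAmax0 : (0 : ℝ) ≤ Amax := zero_le_one.trans hAmax
    exact
      { card_le := hcard𝔏
        exists_ne := by
          obtain ⟨i, hi⟩ := hne
          exact ⟨i, hsupp i hi, hi⟩
        deg_ne := fun i hi i' hi' => hdeg_ne i (hsub hi) i' (hsub hi')
        R_ne := fun i hi => hR_ne i (hsub hi)
        deg_le := fun i hi => hdeg_le i (hsub hi)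
        p_le := by
          intro i _
          refine (hbound i).trans (le_trans ?_ hP)
          exact Int.ceil_le_ceil (mul_le_mul_of_nonneg_right (by exact_mod_cast hcard𝔏) hAmax0)
        u_le := fun i hi => hu i (hsub hi)
        uθ_le := fun i hi => huθ i (hsub hi)
        dir_le := fun i hi => hdir i (hsub hi)
        slab := fun i hi => hslab i₀ hi₀ i hi
        wt := fun i hi => hwt i (hsub hi)
        hasse := fun i hi => hhasse i (hsub hi)
        shape := ⟨fun i hi => hvbox i (hsub hi), hSh 𝔏 hsub i₀ hi₀ p⟩ }
  · intro x hx _ τ hτ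
    exact hsol (x, τ) (mem_Icc_product_tauSet hx hτ)

end TwoSetup

end Summit.ABC.StewartYu

end
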